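import Literature.NumberTheory.EllipticCurves.PAdicTwoVariableUnitsClosure
import HarnessLib

/-!
# Galois translates of a family of tower units by DENSITY: if the translates `σ̃_a·β_c` by an index family `σ̃_a ∈ Γ_F` that approximates
# every `σ ∈ Γ_F` on the finite layers `E_N·K_π^{N+1}` lie in a closed set `S₀`, then so do ALL translates `σ·β_c` — the `hgen`
# hypothesis of the (c)-identity from II §2.4 (ii) on Artin symbols + density

De Shalit, *Iwasawa theory of elliptic curves with complex multiplication* (1987), II §2.4 (ii), §4.12 (p. 68: "we can find 𝔞's such that …
converge"), III §1.4 (`𝒞_𝔣` "is Galois-stable").  The generated / Galois forms of the local (c)-identity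
(`Theorems/PrintCf2RubinValueTwoColemanCoinvariantChar{Generated,Principal,Galois}`) carry the hypothesis
`hgen : ∀ σ c, σ·β_c ∈ 𝒞̄ = closure ⟨β_c^{±1}⟩` for EVERY `σ ∈ Γ_F`.  For the elliptic units only the translates by (local lifts of) Artin symbols
of index ideals are given algebraically (`σ_𝔞 e(𝔠) = e(𝔞𝔠)·e(𝔞)^{−N𝔠}`, II §2.4 (ii)); the rest is density: the Artin symbols exhaust every finite
layer `Gal(K(𝔤𝔭̄^{m+1}𝔭^{k+1})/K)`, and `σ ↦ σ·β` is continuous for the product topology.  THIS file proves the density step in the lane's frame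
(everything PROVED, 0 sorry, no definitions, no named facts):

* `val_galAct_eq_of_forall_smul_eq` — if `σ̃` and `σ` agree on `E_m·K_π^{k+1}` then `(σ̃·β)_k = (σ·β)_k` for `β ∈ 𝒰(E_m·K_π^∞)`;
* ★ `tendsto_galAct_of_forall_smul_eq` — if `σ̃_N` agrees with `σ` on `E_N·K_π^{N+1}` for every `N`, then `σ̃_N·x → σ·x` for every tower family `x`;
* ★★ **`galAct_mem_of_isClosed_of_approx`** — `S₀` closed, `σ̃_a·x ∈ S₀` for all `a`, and every `σ` approximated on every finite layer by some `σ̃_a`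
  ⟹ `σ·x ∈ S₀` for every `σ`;
* ★★ **`galAct_mem_closure_unitsGen_of_approx`** — the `hgen` of `galAct_mem_closure_unitsGen` from its restriction to an approximating index family:
  `(∀ a c, σ̃_a·β_c ∈ closure ⟨β^{±1}⟩) ⟹ (∀ σ c, σ·β_c ∈ closure ⟨β^{±1}⟩)`.

Cell `bsd-print-cf2`, width seat `bsd-line-cf2c-w7` g14.

## References
* E. de Shalit, *Iwasawa theory of elliptic curves with complex multiplication* (1987), Ch. II §2.4 (ii), §4.12 (p. 68); Ch. III §1.4. [deShalit1987]
* N. Bourbaki, *General Topology*, Ch. I §2.1, §4.2 (product topology; closed sets and limits). [BourbakiGT1]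
-/

noncomputable section

namespace Literature.NumberTheory.EllipticCurves

open _root_.Filter _root_.Topology
open ValuativeRel Field
open Literature.NumberTheory.GaloisRepresentations Literature.NumberTheory.GaloisRepresentations.IsNonarchimedeanLocalField
  Literature.NumberTheory.GaloisRepresentations.LubinTate

variable {F : Type} [Field F] [ValuativeRel F] [TopologicalSpace F] [IsNonarchimedeanLocalField F]

attribute [local instance] ltNormUniformSpace ltNormIsUniformAddGroup rk1 nF nE fintypeResidueField

variable {π : 𝒪[F]} (hπ : (valuation F).IsUniformizer (π : F))

/-! ### §1. One layer: agreement on `E·K_π^{k+1}` gives equal components -/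

section OneLevel

variable (E : IntermediateField F (AlgebraicClosure F)) [FiniteDimensional F E] [Normal F E]

/-- **If `σ̃` and `σ` agree on the field `E·K_π^{k+1}` then `(σ̃·β)_k = (σ·β)_k`.** [cite: deShalit1987, Ch. I §2.3 (iv)] -/
theorem val_galAct_eq_of_forall_smul_eq {σ' σ : absoluteGaloisGroup F} {k : ℕ}
    (h : ∀ z : (E ⊔ ltField π k : IntermediateField F (AlgebraicClosure F)), σ' • (z : AlgebraicClosure F) = σ • (z : AlgebraicClosure F))
    (β : RelNormCoherentUnits hπ E) : (β.galAct σ').val k = (β.galAct σ).val k :=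
  Subtype.ext (Subtype.ext (by rw [RelNormCoherentUnits.coe_val_galAct, RelNormCoherentUnits.coe_val_galAct, coe_relRestrict_apply,
    coe_relRestrict_apply, h]))

end OneLevel

/-! ### §2. The tower: approximation on the finite layers gives convergence of the translates -/

section Tower

variable (E : ℕ → IntermediateField F (AlgebraicClosure F)) [∀ m, FiniteDimensional F (E m)] [∀ m, Normal F (E m)] (hmono : Monotone E)

omit [∀ m, FiniteDimensional F (E m)] [∀ m, Normal F (E m)] in
include hπ hmono in
/-- The layers increase in both directions: `E_m·K_π^{k+1} ≤ E_N·K_π^{N+1}` for `m, k ≤ N`. [cite: deShalit1987, Ch. I §3.8 (16)] -/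
theorem sup_ltField_le_of_le {m k N : ℕ} (hm : m ≤ N) (hk : k ≤ N) :
    (E m ⊔ ltField π k : IntermediateField F (AlgebraicClosure F)) ≤ E N ⊔ ltField π N :=
  sup_le_sup (hmono hm) (ltField_mono hπ hk)

include hmono in
/-- ★ **Convergence of the translates**: if `σ̃_N` agrees with `σ` on `E_N·K_π^{N+1}` for every `N`, then for every tower family `x`,
`(σ̃_N·x_m)_m → (σ·x_m)_m` in `∏_m 𝒰(E_m·K_π^∞)` (each component is eventually constant). [cite: deShalit1987, Ch. II §4.12 (p. 68)]
[cite: BourbakiGT1, Ch. I §4.2] -/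
theorem tendsto_galAct_of_forall_smul_eq {τ : ℕ → absoluteGaloisGroup F} {σ : absoluteGaloisGroup F}
    (hτ : ∀ N (z : (E N ⊔ ltField π N : IntermediateField F (AlgebraicClosure F))),
      τ N • (z : AlgebraicClosure F) = σ • (z : AlgebraicClosure F))
    (x : ∀ m, RelNormCoherentUnits hπ (E m)) :
    Tendsto (fun N => fun m => (x m).galAct (τ N)) atTop (𝓝 fun m => (x m).galAct σ) := by
  rw [tendsto_pi_nhds]
  intro m
  rw [(RelNormCoherentUnits.isEmbedding_val hπ (E m)).isInducing.tendsto_nhds_iff, tendsto_pi_nhds]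
  intro k
  refine (tendsto_const_nhds (x := ((x m).galAct σ).val k)).congr' ?_
  filter_upwards [Filter.eventually_ge_atTop (max m k)] with N hN
  change ((x m).galAct σ).val k = ((x m).galAct (τ N)).val k
  refine (val_galAct_eq_of_forall_smul_eq hπ (E m) (fun z => ?_) (x m)).symm
  have hz : (z : AlgebraicClosure F) ∈ (E N ⊔ ltField π N : IntermediateField F (AlgebraicClosure F)) :=
    sup_ltField_le_of_le hπ E hmono ((le_max_left m k).trans hN) ((le_max_right m k).trans hN) z.2
  exact hτ N ⟨z, hz⟩

include hmono in
/-- ★★ **Closed sets capture all translates from an approximating family**: let `S₀ ⊆ ∏_m 𝒰(E_m·K_π^∞)` be closed and `σ̃ : A → Γ_F` a family such that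
every `σ ∈ Γ_F` agrees on every finite layer `E_N·K_π^{N+1}` with some `σ̃_a`; if `σ̃_a·x ∈ S₀` for all `a`, then `σ·x ∈ S₀` for all `σ`.
[cite: deShalit1987, Ch. II §4.12 (p. 68); Ch. III §1.4] [cite: BourbakiGT1, Ch. I §2.1, §4.2] -/
theorem galAct_mem_of_isClosed_of_approx {A : Type*} (τ : A → absoluteGaloisGroup F)
    (happrox : ∀ (σ : absoluteGaloisGroup F) (N : ℕ), ∃ a : A, ∀ z : (E N ⊔ ltField π N : IntermediateField F (AlgebraicClosure F)),
      τ a • (z : AlgebraicClosure F) = σ • (z : AlgebraicClosure F))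
    {S₀ : Set (∀ m, RelNormCoherentUnits hπ (E m))} (hS₀ : IsClosed S₀) (x : ∀ m, RelNormCoherentUnits hπ (E m))
    (hx : ∀ a, (fun m => (x m).galAct (τ a)) ∈ S₀) (σ : absoluteGaloisGroup F) :
    (fun m => (x m).galAct σ) ∈ S₀ := by
  choose a ha using happrox σ
  exact hS₀.mem_of_tendsto (tendsto_galAct_of_forall_smul_eq hπ E hmono (τ := fun N => τ (a N)) ha x)
    (Filter.Eventually.of_forall fun N => hx (a N))

attribute [local instance] RelNormCoherentUnits.instCommMonoid

variable {I : Type*} (β : I → ∀ m, RelNormCoherentUnits hπ (E m))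

include hmono in
/-- ★★ **`hgen` from an approximating index family** (II §2.4 (ii) on Artin symbols + density): if the translates `σ̃_a·β_c` of the generators by an
index family `σ̃ : A → Γ_F` approximating every `σ ∈ Γ_F` on every finite layer lie in `𝒞̄ = closure ⟨β_c^{±1}⟩`, then so do all translates
`σ·β_c` — the hypothesis `hgen` of `galAct_mem_closure_unitsGen` / of the (c)-identity. [cite: deShalit1987, Ch. II §2.4 (ii), §4.12 (p. 68); Ch. III §1.4] -/
theorem galAct_mem_closure_unitsGen_of_approx {A : Type*} (τ : A → absoluteGaloisGroup F)
    (happrox : ∀ (σ : absoluteGaloisGroup F) (N : ℕ), ∃ a : A, ∀ z : (E N ⊔ ltField π N : IntermediateField F (AlgebraicClosure F)),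
      τ a • (z : AlgebraicClosure F) = σ • (z : AlgebraicClosure F))
    (hgenA : ∀ (a : A) (c : I), (fun m => ((β c) m).galAct (τ a)) ∈
      closure (Submonoid.closure (Set.range β ∪ Set.range fun c => fun m => ((β c) m).inv hπ (E m)) : Set (∀ m, RelNormCoherentUnits hπ (E m))))
    (σ : absoluteGaloisGroup F) (c : I) :
    (fun m => ((β c) m).galAct σ) ∈
      closure (Submonoid.closure (Set.range β ∪ Set.range fun c => fun m => ((β c) m).inv hπ (E m)) : Set (∀ m, RelNormCoherentUnits hπ (E m))) :=
  galAct_mem_of_isClosed_of_approx hπ E hmono τ happrox isClosed_closure (β c) (fun a => hgenA a c) σ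

include hmono in
/-- **Product-rule form**: if for every index pair `(a, c)` the translate `σ̃_a·β_c` is a (closure point of a) word in the `β^{±1}` — e.g.
`σ_𝔞 e(𝔠) = e(𝔞𝔠)·e(𝔞)^{−N𝔠}` for the elliptic units — and the `σ̃_a` approximate `Γ_F`, then `𝒞̄ = closure ⟨β_c^{±1}⟩` contains every `σ·β_c`.
Here the word is given explicitly: `σ̃_a·β_c = β_{μ(a,c)} · (β_a⁻¹)^{n_c}`. [cite: deShalit1987, Ch. II §2.4 (ii); Ch. III §1.4 Remark (i)] -/
theorem galAct_mem_closure_unitsGen_of_mul_rule (τ : I → absoluteGaloisGroup F)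
    (happrox : ∀ (σ : absoluteGaloisGroup F) (N : ℕ), ∃ a : I, ∀ z : (E N ⊔ ltField π N : IntermediateField F (AlgebraicClosure F)),
      τ a • (z : AlgebraicClosure F) = σ • (z : AlgebraicClosure F))
    (μ : I → I → I) (n : I → ℕ)
    (hrule : ∀ a c : I, (fun m => ((β c) m).galAct (τ a)) = β (μ a c) * (fun m => ((β a) m).inv hπ (E m)) ^ n c)
    (σ : absoluteGaloisGroup F) (c : I) :
    (fun m => ((β c) m).galAct σ) ∈
      closure (Submonoid.closure (Set.range β ∪ Set.range fun c => fun m => ((β c) m).inv hπ (E m)) : Set (∀ m, RelNormCoherentUnits hπ (E m))) := by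
  refine galAct_mem_closure_unitsGen_of_approx hπ E hmono β τ happrox (fun a c => subset_closure ?_) σ c
  rw [hrule a c, SetLike.mem_coe]
  refine Submonoid.mul_mem _ (Submonoid.subset_closure ?_) (Submonoid.pow_mem _ (Submonoid.subset_closure ?_) _)
  · exact Or.inl ⟨μ a c, rfl⟩
  · exact Or.inr ⟨a, rfl⟩

end Tower

end Literature.NumberTheory.EllipticCurves
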